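import Summits.QuantumFields.YangMills.Theorems.SwapVirialDeficitBlowUpScaling
import Summits.QuantumFields.YangMills.Theorems.VirialFluxGapDeficitForm
import HarnessLib

/-!
# The scaling identity at EVERY scale, for INTEGRANDS (brick V1 of memo2-24197-window):
# `∫ G(F^S_z) dμ_L = κ·t^{2α} · ∫_B 𝟙_{S_t} · G(F̂ ∘ Φ_t) dβ` for every measurable `G ≥ 0` and every `t > 0`
# (free-hands support of ⟨stmt-QuantumFields-24197⟩ `SwapVirialDeficit.SwapGluedStiffness`)

w2 g57's ✓`BlowUpRing.ringMeasure_swapDeficit_le_eq_blowUp` is the case `G = 𝟙_{(−∞, s]}`: the sublevel volumes of the σ-glued deficit `F^S_z` through the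
joint blow-up chart `Φ_t = blowUpPoint t` at any scale `t > 0`, with the exact Jacobian `κ·t^{2α}`, `κ = coneConst^{6L⁴}`, `2α = 18L⁴ − 2`.  Here:
* §1 `sideSet`, measurability; ★ `map_swapDeficit_eq_blowUp` — the two push-forward LAWS of the deficit agree: `(F^S_z)_* μ_L = κt^{2α} · (F̂∘Φ_t)_* (β|_{S_t})`
  (`Measure.ext_of_Iic`; `μ_L` is a probability measure);
* §2 ★★ `lintegral_comp_swapDeficit_eq_blowUp` — (V1) for every measurable `G : ℝ → ℝ≥0∞`; ★ `laplace_swapDeficit_eq_blowUp` — the Laplace transform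
  `∫ e^{−bF^S_z} dμ_L` through the chart at every scale `t` (the `t`-independence of the right side is the integrated VIRIAL identity of the memo, §2 there).
HONEST LABEL: exact measure-theoretic identities (change of variables already in the tree, repackaged for integrands); no estimate, no limit, nothing about
⟨24197⟩'s window; the Yang–Mills mass gap is NOT proved; no summit is proved by a line.  Seat ym-line-fcl-p3 g45 (cell ym-idea-1, free hands; item of record
⟨24085⟩ aside, untouched), `--supports stmt-QuantumFields-24197`.  THEOREMS + 1 abbreviation-free `def` (`sideSet`), 0 `sorry`, standard axioms; the series'
local `ℍ` instances.  References: [cite: tHooft1979]; [cite: Luscher1983, §2]; [folklore].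
-/

set_option autoImplicit false

noncomputable section

open MeasureTheory Quaternion Set Filter Topology
open scoped Quaternion ENNReal BigOperators
open Literature.MathematicalPhysics.QuantumLattice
open Literature.MathematicalPhysics.QuantumFieldTheory hiding SU2
open Summit.QuantumFields.YangMills.Theorems.SwapTwistDeficit.ToronLog

attribute [local instance] Literature.Analysis.FluidPDE.Tao2016.quatMeasurableSpace
  Literature.Analysis.FluidPDE.Tao2016.quatBorelSpace
  Literature.MathematicalPhysics.QuantumLattice.secondCountableTopology_su2

namespace Summit.QuantumFields.YangMills.Theorems.SwapVirialDeficit.BlowUpRing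

open Summit.QuantumFields.YangMills.Theorems.FemtoTransferGap
open Summit.QuantumFields.YangMills.Theorems.VirialFluxGap.RingDeficit
open Summit.QuantumFields.YangMills.Theorems.SwapVirialDeficit.SwapRing
open Summit.QuantumFields.YangMills.Theorems.SwapVirialDeficit.ZeroModeSigma (dil3 measurable_dil3 ball3 measurableSet_ball3 dilateIm continuous_dilateIm)

variable {L : ℕ} [NeZero L]

/-! ## §1 The side condition and the two laws of the deficit -/

/-- The side condition of the blow-up chart at scale `t`: leader letters in the unit balls after `dil3 t`, followers after `dilateIm t`. [folklore] -/
def sideSet (L : ℕ) [NeZero L] (t : ℝ) : Set (ℍ × (((ℍ × ℍ) × ℍ) × (Fol L → ℍ))) :=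
  {x | dil3 t x.2.1 ∈ ball3 ∧ ∀ i, ‖dilateIm t (x.2.2 i)‖ < 1}

/-- The side condition is measurable. [folklore] -/
theorem measurableSet_sideSet (t : ℝ) : MeasurableSet (sideSet L t) := by
  have h1 : MeasurableSet {x : ℍ × (((ℍ × ℍ) × ℍ) × (Fol L → ℍ)) | dil3 t x.2.1 ∈ ball3} :=
    (measurable_dil3 t).comp (measurable_fst.comp measurable_snd) measurableSet_ball3
  have h2 : MeasurableSet {x : ℍ × (((ℍ × ℍ) × ℍ) × (Fol L → ℍ)) | ∀ i, ‖dilateIm t (x.2.2 i)‖ < 1} :=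
    (measurable_snd.comp measurable_snd) (measurableSet_followerBalls (L := L) t)
  have e : sideSet L t = {x : ℍ × (((ℍ × ℍ) × ℍ) × (Fol L → ℍ)) | dil3 t x.2.1 ∈ ball3} ∩ {x | ∀ i, ‖dilateIm t (x.2.2 i)‖ < 1} := by
    ext x; simp only [sideSet, Set.mem_setOf_eq, Set.mem_inter_iff]
  rw [e]
  exact h1.inter h2

/-- The blow-up event is the side condition cut by the sublevel set of the deficit along the chart. [folklore] -/
theorem blowUpSet_eq_sideSet_inter (z : Fin 3 → Bool) (χ : Site 3 L → SU2) (t s : ℝ) :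
    blowUpSet L z χ t s = sideSet L t ∩ (fun x => chartDeficit L z χ (blowUpPoint (L := L) t x)) ⁻¹' Set.Iic s := by
  ext x
  simp only [blowUpSet, sideSet, Set.mem_setOf_eq, Set.mem_inter_iff, Set.mem_preimage, Set.mem_Iic, and_assoc]

/-- ★ **The two laws of the deficit agree**: for central `χ` and every `t > 0`, the push-forward of `μ_L` under `F^S_z` equals `κ·t^{2α}` times the push-forward
of `β|_{S_t}` under `F̂ ∘ Φ_t` (as measures on `ℝ`). [cite: tHooft1979] [cite: Luscher1983, §2] -/
theorem map_swapDeficit_eq_blowUp (z : Fin 3 → Bool) {χ : Site 3 L → SU2} (hχ : ∀ (x : Site 3 L) (k : SU2), k * χ x = χ x * k) {t : ℝ} (ht : 0 < t) :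
    Measure.map (swapRingDeficit L z) (ringMeasure L) =
      ENNReal.ofReal (coneConst ^ (6 * L ^ 4) * t ^ (18 * L ^ 4 - 2)) •
        Measure.map (fun x => chartDeficit L z χ (blowUpPoint (L := L) t x))
          ((coneMeasure.prod ((volume : Measure ((ℍ × ℍ) × ℍ)).prod (Measure.pi fun _ : Fol L => (volume : Measure ℍ)))).restrict (sideSet L t)) := by
  haveI := isProbabilityMeasure_ringMeasure (L := L)
  haveI : IsFiniteMeasure (Measure.map (swapRingDeficit L z) (ringMeasure L)) :=
    Measure.isFiniteMeasure_map _ _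
  have hF : Measurable (swapRingDeficit L z) := measurable_swapRingDeficit z
  have hG : Measurable (fun x : ℍ × (((ℍ × ℍ) × ℍ) × (Fol L → ℍ)) => chartDeficit L z χ (blowUpPoint (L := L) t x)) :=
    (measurable_chartDeficit z χ).comp (measurable_blowUpPoint t)
  refine Measure.ext_of_Iic _ _ fun s => ?_
  rw [Measure.map_apply hF measurableSet_Iic, Measure.smul_apply, Measure.map_apply hG measurableSet_Iic,
    Measure.restrict_apply' (measurableSet_sideSet (L := L) t), smul_eq_mul]
  have e1 : swapRingDeficit L z ⁻¹' Set.Iic s = {P | swapRingDeficit L z P ≤ s} := rfl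
  rw [e1, ringMeasure_swapDeficit_le_eq_blowUp z hχ ht s, blowUpSet_eq_sideSet_inter, Set.inter_comm]

/-! ## §2 (V1): integrands through the chart, at every scale -/

/-- ★★ **(V1) THE SCALING IDENTITY FOR INTEGRANDS, AT EVERY SCALE**: for central `χ`, every measurable `G : ℝ → ℝ≥0∞` and every `t > 0`,
`∫⁻ G(F^S_z(P)) dμ_L = ofReal(coneConst^{6L⁴}·t^{18L⁴−2}) · ∫⁻ 𝟙_{S_t}(x)·G(chartDeficit (blowUpPoint t x)) dβ`. [cite: tHooft1979] [cite: Luscher1983, §2] -/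
theorem lintegral_comp_swapDeficit_eq_blowUp (z : Fin 3 → Bool) {χ : Site 3 L → SU2} (hχ : ∀ (x : Site 3 L) (k : SU2), k * χ x = χ x * k)
    (G : ℝ → ℝ≥0∞) (hGm : Measurable G) {t : ℝ} (ht : 0 < t) :
    ∫⁻ P, G (swapRingDeficit L z P) ∂(ringMeasure L) =
      ENNReal.ofReal (coneConst ^ (6 * L ^ 4) * t ^ (18 * L ^ 4 - 2)) *
        ∫⁻ x, (sideSet L t).indicator (fun x => G (chartDeficit L z χ (blowUpPoint (L := L) t x))) x
          ∂(coneMeasure.prod ((volume : Measure ((ℍ × ℍ) × ℍ)).prod (Measure.pi fun _ : Fol L => (volume : Measure ℍ)))) := by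
  have hF : Measurable (swapRingDeficit L z) := measurable_swapRingDeficit z
  have hG : Measurable (fun x : ℍ × (((ℍ × ℍ) × ℍ) × (Fol L → ℍ)) => chartDeficit L z χ (blowUpPoint (L := L) t x)) :=
    (measurable_chartDeficit z χ).comp (measurable_blowUpPoint t)
  rw [← lintegral_map hGm hF, map_swapDeficit_eq_blowUp z hχ ht, lintegral_smul_measure, lintegral_map hGm hG,
    ← lintegral_indicator (measurableSet_sideSet (L := L) t), smul_eq_mul]

/-- ★ **The Laplace transform of the σ-glued deficit through the chart, at every scale `t > 0`**:
`∫⁻ ofReal(e^{−b·F^S_z}) dμ_L = ofReal(coneConst^{6L⁴}·t^{18L⁴−2}) · ∫⁻ 𝟙_{S_t}·ofReal(e^{−b·chartDeficit(blowUpPoint t x)}) dβ` — the right side is therefore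
INDEPENDENT of `t` (integrated virial identity). [cite: tHooft1979] [cite: Luscher1983, §2] -/
theorem laplace_swapDeficit_eq_blowUp (z : Fin 3 → Bool) {χ : Site 3 L → SU2} (hχ : ∀ (x : Site 3 L) (k : SU2), k * χ x = χ x * k)
    (b : ℝ) {t : ℝ} (ht : 0 < t) :
    ∫⁻ P, ENNReal.ofReal (Real.exp (-b * swapRingDeficit L z P)) ∂(ringMeasure L) =
      ENNReal.ofReal (coneConst ^ (6 * L ^ 4) * t ^ (18 * L ^ 4 - 2)) *
        ∫⁻ x, (sideSet L t).indicator (fun x => ENNReal.ofReal (Real.exp (-b * chartDeficit L z χ (blowUpPoint (L := L) t x)))) x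
          ∂(coneMeasure.prod ((volume : Measure ((ℍ × ℍ) × ℍ)).prod (Measure.pi fun _ : Fol L => (volume : Measure ℍ)))) :=
  lintegral_comp_swapDeficit_eq_blowUp z hχ (fun s => ENNReal.ofReal (Real.exp (-b * s)))
    (ENNReal.measurable_ofReal.comp (Real.measurable_exp.comp (measurable_const.mul measurable_id))) ht

/-- ★ **Scale independence of the chart integral** (the integrated virial identity): for central `χ`, measurable `G` and `0 < t₁, t₂`,
`t₁^{18L⁴−2}·∫⁻ 𝟙_{S_{t₁}}·G(F̂∘Φ_{t₁}) dβ = t₂^{18L⁴−2}·∫⁻ 𝟙_{S_{t₂}}·G(F̂∘Φ_{t₂}) dβ`. [folklore] -/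
theorem chartIntegral_scale_invariant (z : Fin 3 → Bool) {χ : Site 3 L → SU2} (hχ : ∀ (x : Site 3 L) (k : SU2), k * χ x = χ x * k)
    (G : ℝ → ℝ≥0∞) (hGm : Measurable G) {t₁ t₂ : ℝ} (ht₁ : 0 < t₁) (ht₂ : 0 < t₂) :
    ENNReal.ofReal (t₁ ^ (18 * L ^ 4 - 2)) *
        ∫⁻ x, (sideSet L t₁).indicator (fun x => G (chartDeficit L z χ (blowUpPoint (L := L) t₁ x))) x
          ∂(coneMeasure.prod ((volume : Measure ((ℍ × ℍ) × ℍ)).prod (Measure.pi fun _ : Fol L => (volume : Measure ℍ)))) =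
      ENNReal.ofReal (t₂ ^ (18 * L ^ 4 - 2)) *
        ∫⁻ x, (sideSet L t₂).indicator (fun x => G (chartDeficit L z χ (blowUpPoint (L := L) t₂ x))) x
          ∂(coneMeasure.prod ((volume : Measure ((ℍ × ℍ) × ℍ)).prod (Measure.pi fun _ : Fol L => (volume : Measure ℍ)))) := by
  have hc : 0 < coneConst ^ (6 * L ^ 4) := pow_pos coneConst_pos _
  have h1 := lintegral_comp_swapDeficit_eq_blowUp z hχ G hGm ht₁
  have h2 := lintegral_comp_swapDeficit_eq_blowUp z hχ G hGm ht₂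
  rw [h1, ENNReal.ofReal_mul hc.le, ENNReal.ofReal_mul hc.le, mul_assoc, mul_assoc] at h2
  have hk : ENNReal.ofReal (coneConst ^ (6 * L ^ 4)) ≠ 0 := by
    rw [ne_eq, ENNReal.ofReal_eq_zero, not_le]; exact hc
  exact (ENNReal.mul_right_inj hk ENNReal.ofReal_ne_top).1 h2

end Summit.QuantumFields.YangMills.Theorems.SwapVirialDeficit.BlowUpRing

end
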